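import Summits.QuantumFields.BalabanUV.T4Continuum.Support.NE7ClassCurrentBound
import HarnessLib

/-!
# NE7ClassCurrentBoundGeneric — PORT MAP P2.3a: THE CURRENT OF OUR TANGENT-CRITICAL CONFIGURATIONS IN THE CLASS, `d = 4`, ANY BLOCK SIZE `L ≥ 2`, ANY `U(n)`, READ AS ONE
# k-FREE CONSTANT — `NE7ClassCurrentBound.exists_classCurrentConst` (F301, `L = 2`, `ε ≤ 10⁻⁵³`) RE-ISSUED GENERICALLY: `‖covDiv 1 U ν y‖ ≤ C(L, card n)·r∕M³` (`M = L^{k+1}`) at every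
# bond of every tangent-critical `U ∈ admissible (sfClass 4 L N ε) L (k+1) D` with `SmallField U (r∕M²)`, `r ≤ 1∕4`, under the two displayed ε-lines `2·thetaLoc 4 L·ε ≤ 1`,
# `∀ k, LevelSmall 4 L k (ε∕M²)` (the record's `L = 2` numerics `thetaLoc 4 2 < 10¹⁹`, `levelSmall_all_d4_L2` are exactly these at `ε ≤ 10⁻⁵³`)

Cell `pub-balaban`, rung (B)+1 sub-cell t4, lineage `b2b-balaban-t4-ne7-p1`, generation 109 (CRUX PROVER NE7 #1 = OWNER of BINDER row NE7).  Memo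
`t4/b2b-balaban-t4-ne7-p1-g109/ROAD-G109.md` §3 (PORT MAP item P2.3a; consumer: the generic re-issue of F306 `hint_of_landauELChart`).
WHAT ([folklore]; 0 def, 0 sorry).  `geom_identity` (`M⁴∕M²·(L∕L⁴)^{k+1} = M⁻¹`); **`exists_classCurrentConst_generic`** — F296 `NE7CovDivGeneralDatum.norm_covDiv_le_of_tanCritical_gen`
(any `d, L`) with its side letters discharged from the two ε-lines, made periodic (`NE7ClassCurrentBound.covDiv_cmod`), constant `C = card n·2·curl1C 4 L·E(L) + (12·#Plane·card n + 32)∕4`.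
HONEST FRAMING (page 1): a repackaging of F296 (elementary lattice analysis of OUR objects at a tangent-critical configuration); tangent-criticality is a HYPOTHESIS on `U`; nothing of
Bałaban's asserted; NE7 NOT proved; spine 0∕9; finite T⁴ rung (B)+1 — NOT infinite volume, NOT mass gap, NOT BetaPertH, NOT Clay (continuum YM on T⁴ ⇐ BetaPertH ∧ nine spine estimates).
-/


set_option autoImplicit false

open scoped BigOperators Matrix.Norms.L2Operator
open NormedSpace Finset

namespace Summit.QuantumFields.BalabanUV.T4Continuum.NE7ClassCurrentBoundGeneric

open Literature.MathematicalPhysics.QuantumFieldTheory.Balaban1983to89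
open B7Prop1Explicit B7Prop2Explicit
open B8Ineq132 (covDiv norm_covDiv_gaugeAct)
open T4AveragingDeficitWall (IsUnitaryCfg IsSkewDir SmallField)
open T4AveragingDeficitWallBoundary (IsPeriodicCfg periodBox)
open AveragingDeficitPeriodicCounting (IsPeriodicDir)
open AveragingDeficitMultiLevelPrep (LevelSmall TangentIter)
open AveragingDeficitTransport (mem_U1_of_unitary)
open AveragingDeficitTorusChart (periodic_smul_vec)
open BlockAverageVaryHolo (nbRad)
open AveragingDeficitTwoLevelPrep (twoLevelSmall)
open MinimalActionLevels (perWin)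
open MinimalActionSandwich (admissible)
open MinimalActionRate (sfClass)
open NE3HessForm (dAction)
open NE3TangentCovariantTower (dirIter tangentIter_iff_dirIter_eq_zero)
open NE3QbarIterCovLiftPrep (cruxC)
open NE3RightInverseSolveLetters (thetaLoc cruxC_le_thetaLoc cruxC_nonneg)
open NE3HatInvCurlLetters (curl1C curl1C_nonneg)
open NE7CovDivGeneralDatum (norm_covDiv_le_of_tanCritical_gen)
open SmoothRefineAbelianFlux (hol_add_period)
open SkeletonLattice (cmod cdiv smul_cdiv_add_cmod)
open NE7LatticeLandauMinimiser (cmod_mem_periodBox)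
open NE7ClassCurrentBound (covDiv_cmod)

noncomputable section

variable {n : Type*} [Fintype n] [DecidableEq n]

/-! ## §2 The geometric identity of the letters -/

/-- `M⁴∕M²·(L∕L⁴)^{k+1} = 1∕M` for `M = L^{k+1}`, `L ≥ 1`. [folklore] -/
theorem geom_identity {L : ℕ} (hL : 1 ≤ L) (k : ℕ) :
    ((L : ℝ) ^ (k + 1)) ^ 4 / ((L : ℝ) ^ (k + 1)) ^ 2 * (((L : ℝ)) / (L : ℝ) ^ 4) ^ (k + 1) = 1 / (L : ℝ) ^ (k + 1) := by
  have hL0 : (0 : ℝ) < L := by exact_mod_cast hL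
  have hM : (0 : ℝ) < (L : ℝ) ^ (k + 1) := by positivity
  have h16 : ((L : ℝ) ^ 4) ^ (k + 1) = ((L : ℝ) ^ (k + 1)) ^ 4 := by rw [← pow_mul, ← pow_mul, mul_comm]
  rw [div_pow, h16]
  field_simp

/-! ## §3 The class current bound -/

set_option maxHeartbeats 800000 in
/-- **THE CURRENT OF OUR TANGENT-CRITICAL CONFIGURATIONS, ONE CONSTANT — ANY BLOCK SIZE `L ≥ 2`, ANY `U(n)`.**  There is `C ≥ 0` (depending on `L` and `card n` only) such that for
every `N ≥ 1`, every class radius `0 < ε ≤ 1` with `2·thetaLoc 4 L·ε ≤ 1` and the level family `∀ k, LevelSmall 4 L k (ε∕(L^{k+1})²)` (both supplied by the class package of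
`NE7EnergyClassPoincareGeneric` after one more shrink of the radius), every datum `D`, level `k`, every tangent-critical `U ∈ admissible (sfClass 4 L N ε) L (k+1) D`, and every
`0 ≤ r ≤ 1∕4` with `SmallField U (r∕M²)` (`M = L^{k+1}`): `‖covDiv 1 U ν y‖ ≤ C·r∕M³` at every site `y` and component `ν` — F301 (`NE7ClassCurrentBound.exists_classCurrentConst`,
`L = 2`, `ε ≤ 10⁻⁵³`) under the PORT MAP recipe; the two `L = 2` numerics (`thetaLoc 4 L < 10¹⁹`, `levelSmall_all_d4_L2`) become the two displayed ε-hypotheses. [folklore] -/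
theorem exists_classCurrentConst_generic [Nonempty n] {L : ℕ} (hL : 2 ≤ L) :
    ∃ C : ℝ, 0 ≤ C ∧ ∀ (N : ℕ) [NeZero N] (ε : ℝ), 0 < ε → ε ≤ 1 → 2 * thetaLoc 4 L * ε ≤ 1 →
      (∀ k : ℕ, LevelSmall 4 L k (ε / ((L : ℝ) ^ (k + 1)) ^ 2)) →
      ∀ (D : Site 4 → Fin 4 → (Matrix n n ℂ)ˣ) (k : ℕ), ∀ U ∈ admissible (sfClass 4 L N ε) L (k + 1) D,
      (∀ φ : Site 4 → Fin 4 → Matrix n n ℂ, IsSkewDir φ → IsPeriodicDir φ ((N * L ^ (k + 1) : ℕ) : ℤ) → TangentIter L k U φ →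
        dAction U φ (perWin 4 (N * L ^ (k + 1))) = 0) →
      ∀ r : ℝ, 0 ≤ r → r ≤ 1 / 4 → SmallField U (r / ((L : ℝ) ^ (k + 1)) ^ 2) →
      ∀ (ν : Fin 4) (y : Site 4), ‖covDiv 1 U ν y‖ ≤ C * r / ((L : ℝ) ^ (k + 1)) ^ 3 := by
  have hL1 : 1 ≤ L := by omega
  have hL0 : (0 : ℝ) < L := by exact_mod_cast (show 0 < L by omega)
  -- the exponential constant of F296 at `d = 4`, block size `L`
  set E : ℝ := Real.exp (((L : ℝ) ^ 4 / L) * (((4 : ℕ) : ℝ) * (16 * (((4 : ℕ) : ℝ) + 1) * (((4 : ℕ) : ℝ) + 4) * (L : ℝ) ^ 2)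
      * (1250 * ((nbRad 4 L : ℝ) + L) + 8 * (((4 : ℕ) : ℝ) * L) + 2 * L)) * (2 / twoLevelSmall 4 L)) with hE
  have hE0 : 0 ≤ E := (Real.exp_pos _).le
  refine ⟨(Fintype.card n : ℝ) * (2 * curl1C 4 L * E) + (12 * (Fintype.card (T4AveragingDeficitWall.Plane 4) : ℝ) * (Fintype.card n : ℝ) + 32) / 4,
    by have := curl1C_nonneg 4 L; positivity, ?_⟩
  intro N _ ε hε hε1' hθε hls D k U hU hcrit r hr0 hr4 hUr ν y
  -- names
  have hM0 : (0 : ℝ) < (L : ℝ) ^ (k + 1) := by positivity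
  have hM1 : (1 : ℝ) ≤ (L : ℝ) ^ (k + 1) := one_le_pow₀ (by exact_mod_cast hL1)
  set M : ℝ := (L : ℝ) ^ (k + 1) with hMdef
  -- class data
  have hUu : IsUnitaryCfg U := hU.1.1
  have hUP : IsPeriodicCfg U ((N * L ^ (k + 1) : ℕ) : ℤ) := hU.1.2.1
  have hUx : SmallField U (ε / M ^ 2) := hU.1.2.2
  have hx : 0 ≤ ε / M ^ 2 := by positivity
  have hs : LevelSmall 4 L k (ε / M ^ 2) := hls k
  have hMx : M ^ 2 * (ε / M ^ 2) = ε := by field_simp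
  have hθl' : thetaLoc 4 L * ε < 1 := by linarith [mul_nonneg ((cruxC_nonneg 4 L).trans (cruxC_le_thetaLoc 4 L)) hε.le]
  have hθl : thetaLoc 4 L * (M ^ 2 * (ε / M ^ 2)) < 1 := by rw [hMx]; exact hθl'
  have hθ : cruxC 4 L * (M ^ 2 * (ε / M ^ 2)) < 1 := by
    rw [hMx]; exact lt_of_le_of_lt (mul_le_mul_of_nonneg_right (cruxC_le_thetaLoc 4 L) hε.le) hθl'
  have hε1 : M ^ 2 * (ε / M ^ 2) ≤ 1 := by rw [hMx]; exact hε1'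
  have ha4 : r / M ^ 2 ≤ 1 / 4 := by
    rw [div_le_iff₀ (by positivity)]
    nlinarith [one_le_pow₀ (M₀ := ℝ) (a := M) hM1 (n := 2)]
  have hcrit' : ∀ Y' : Site 4 → Fin 4 → Matrix n n ℂ, IsSkewDir Y' → IsPeriodicDir Y' ((N * L ^ (k + 1) : ℕ) : ℤ) →
      dirIter L (k + 1) U Y' = 0 → dAction U Y' (perWin 4 (N * L ^ (k + 1))) = 0 :=
    fun Y' h1 h2 h3 => hcrit Y' h1 h2 ((tangentIter_iff_dirIter_eq_zero L k U Y').2 h3)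
  have hu1 : ∀ x : Site 4, (fun _ : Site 4 => (1 : (Matrix n n ℂ)ˣ)) x ∈ unitaryUnits (Matrix n n ℂ) := fun _ => (unitaryUnits _).one_mem
  -- reduction to the period box
  have hP1 : 1 ≤ N * L ^ (k + 1) := Nat.one_le_iff_ne_zero.mpr (mul_ne_zero (NeZero.ne N) (pow_ne_zero _ (by omega)))
  have hy₀ : cmod (N * L ^ (k + 1)) y ∈ periodBox (d := 4) (N * L ^ (k + 1)) := cmod_mem_periodBox hP1 y
  rw [covDiv_cmod hUP 1 ν y]
  -- F296 at the representative
  have h := norm_covDiv_le_of_tanCritical_gen (d := 4) (n := n) (L := L) hL k (N := N) hUu hUP hx hs hUx hθ hθl hε1 (by positivity) ha4 hUr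
    hcrit' hu1 (η := (1 : ℝ)) one_ne_zero hy₀ ν
  rw [norm_covDiv_gaugeAct 1 (fun w => mem_U1_of_unitary (hu1 w)) U ν, ← hE, ← hMdef] at h
  refine h.trans ?_
  -- the constant
  rw [hMx, abs_one, inv_one, one_mul]
  have hgeom : M ^ 4 / M ^ 2 * (((L : ℝ)) / (L : ℝ) ^ 4) ^ (k + 1) = 1 / M := by rw [hMdef]; exact geom_identity hL1 k
  have hθε' : 1 - thetaLoc 4 L * ε ≥ 1 / 2 := by linarith
  have hc0 := curl1C_nonneg 4 L
  -- main term: `a·(curl1C∕(1−θε))·(M⁴∕M²)·E·(2∕16)^{k+1} = (r∕M²)·(curl1C∕(1−θε))·E∕M ≤ 2·curl1C·E·r∕M³`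
  have hmain : (r / M ^ 2 * ((curl1C 4 L / (1 - thetaLoc 4 L * ε)) * (M ^ 4 / M ^ 2))) * E * (((L : ℝ)) / (L : ℝ) ^ 4) ^ (k + 1)
      ≤ 2 * curl1C 4 L * E * (r / M ^ 3) := by
    have e1 : (r / M ^ 2 * ((curl1C 4 L / (1 - thetaLoc 4 L * ε)) * (M ^ 4 / M ^ 2))) * E * (((L : ℝ)) / (L : ℝ) ^ 4) ^ (k + 1)
        = (curl1C 4 L / (1 - thetaLoc 4 L * ε)) * E * (r / M ^ 2 * (M ^ 4 / M ^ 2 * (((L : ℝ)) / (L : ℝ) ^ 4) ^ (k + 1))) := by ring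
    rw [e1, hgeom, show r / M ^ 2 * (1 / M) = r / M ^ 3 by rw [div_mul_div_comm, mul_one, ← pow_succ]]
    have h2 : curl1C 4 L / (1 - thetaLoc 4 L * ε) ≤ 2 * curl1C 4 L := by
      rw [div_le_iff₀ (by linarith)]; nlinarith
    have h3 : 0 ≤ r / M ^ 3 := by positivity
    have := mul_le_mul_of_nonneg_right (mul_le_mul_of_nonneg_right h2 hE0) h3
    linarith
  -- the `a²` terms: `a² = r²∕M⁴ ≤ (r∕4)∕M³`
  have ha2 : (r / M ^ 2) ^ 2 ≤ r / 4 / M ^ 3 := by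
    rw [div_pow, div_div, div_le_div_iff₀ (by positivity) (by positivity)]
    have : r ^ 2 ≤ r / 4 * 1 := by nlinarith
    have hM34 : M ^ 3 ≤ (M ^ 2) ^ 2 := by nlinarith [pow_le_pow_right₀ hM1 (show 3 ≤ 4 by norm_num)]
    calc r ^ 2 * (4 * M ^ 3) = 4 * r ^ 2 * M ^ 3 := by ring
      _ ≤ r * M ^ 3 := by nlinarith [pow_pos hM0 3]
      _ ≤ r * (M ^ 2) ^ 2 := by nlinarith
  have hcard : (0 : ℝ) ≤ (Fintype.card n : ℝ) := Nat.cast_nonneg _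
  have hpl : (0 : ℝ) ≤ (Fintype.card (T4AveragingDeficitWall.Plane 4) : ℝ) := Nat.cast_nonneg _
  have hfin : (Fintype.card n : ℝ) * ((r / M ^ 2 * ((curl1C 4 L / (1 - thetaLoc 4 L * ε)) * (M ^ 4 / M ^ 2))) * E * (((L : ℝ)) / (L : ℝ) ^ 4) ^ (k + 1)
        + 12 * (Fintype.card (T4AveragingDeficitWall.Plane 4) : ℝ) * (r / M ^ 2) ^ 2) + 8 * ((4 : ℕ) : ℝ) * (r / M ^ 2) ^ 2
      ≤ ((Fintype.card n : ℝ) * (2 * curl1C 4 L * E) + (12 * (Fintype.card (T4AveragingDeficitWall.Plane 4) : ℝ) * (Fintype.card n : ℝ) + 32) / 4) * r / M ^ 3 := by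
    have t1 := mul_le_mul_of_nonneg_left (add_le_add hmain (mul_le_mul_of_nonneg_left ha2 (by positivity : (0 : ℝ) ≤ 12 * (Fintype.card (T4AveragingDeficitWall.Plane 4) : ℝ)))) hcard
    have t2 := mul_le_mul_of_nonneg_left ha2 (by norm_num : (0 : ℝ) ≤ 8 * ((4 : ℕ) : ℝ))
    have e : ((Fintype.card n : ℝ) * (2 * curl1C 4 L * E) + (12 * (Fintype.card (T4AveragingDeficitWall.Plane 4) : ℝ) * (Fintype.card n : ℝ) + 32) / 4) * r / M ^ 3
        = (Fintype.card n : ℝ) * (2 * curl1C 4 L * E * (r / M ^ 3) + 12 * (Fintype.card (T4AveragingDeficitWall.Plane 4) : ℝ) * (r / 4 / M ^ 3))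
          + 8 * ((4 : ℕ) : ℝ) * (r / 4 / M ^ 3) := by push_cast; ring
    rw [e]; linarith
  linarith [hfin]

end

end Summit.QuantumFields.BalabanUV.T4Continuum.NE7ClassCurrentBoundGeneric
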